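import Literature.AlgebraicGeometry.Morphisms.ZariskiConnectednessProper
import Literature.AlgebraicGeometry.FundamentalGroup.IdempotentSections
import Mathlib.AlgebraicGeometry.Artinian
import HarnessLib

/-!
# Zariski's connectedness theorem over an arbitrary local ring, from a Noetherian proper model

The Stacks Project proves Tag 03H2 (1) (geometrically connected fibres of the Stein factorisation
`X → S'` of a proper `f : X → S`) over a general base from the Noetherian case by Noetherian
approximation: Tag 0G7X (Derived Categories of Schemes, Lemma lemma-proper-idempotent-on-fibre),
general case: "we can write `(f : X → S) = lim (f_i : X_i → S_i)` with `f_i` proper and `S_i`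
Noetherian [Limits, Tag 0A0Q] … `X_s = lim X_{i,s_i}` … Hence `e` is the image of some idempotent
`e_i ∈ H⁰(X_{i, s_i}, 𝒪)` … By the Noetherian case there is an element `ẽ_i` in the stalk
`(f_{i,*}𝒪_{X_i})_{s_i}` mapping to `e_i`. Taking the pullback of `ẽ_i` we get an element `ẽ` of
`(f_*𝒪_X)_s` mapping to `e`."

This file isolates what that argument needs from the approximation, in a form that asks for ONE
Noetherian proper model dominating the closed fibre rather than a limit presentation. Let `B` be a
local ring with residue field `κ`, `g : Y → Spec B`, and write `Y₀ = Y ×_B κ` for the closed fibre and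
`(H_g)` for the statement "every idempotent of `Γ(Y₀, 𝒪)` is the restriction of a global function
on `Y`" (Tag 0G7X over the local base `Spec B`, where `(g_*𝒪_Y)_𝔪 = Γ(Y, 𝒪_Y)`).

* `eq_of_basicOpen_eq`, `exists_isIdempotentElem_basicOpen_eq` — idempotent functions on a scheme
  are determined by, and exist for, their (clopen) non-vanishing loci.
* `idempotentLifting_of_isPullback` — **`(H_{g⁺})` for a base change `Y⁺ = Y' ×_{B₀} B` of a
  proper `Y' → Spec B₀` with `B₀` Noetherian** (any `B₀ → B`): by Zariski's connectedness theorem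
  over the Noetherian ring `B₀` (`geometricallyConnected_toSpecΓ_of_isProper`,
  `Literature/AlgebraicGeometry/Morphisms/ZariskiConnectednessProper.lean`) the fibres of
  `Y' → Spec Γ(Y', 𝒪)` are geometrically connected, so `Y⁺₀ = Y' ×_{B₀} κ → T = Spec Γ(Y', 𝒪) ×_{B₀} κ`
  (a finite discrete `κ`-scheme, `Γ(Y', 𝒪)` being finite over `B₀`) has connected fibres; hence an
  idempotent `e` of `Γ(Y⁺₀, 𝒪)` is the pull-back of an idempotent `ε` of `Γ(T, 𝒪)`, which lifts to
  `Γ(Spec Γ(Y', 𝒪) ×_{B₀} Spec B, 𝒪)` (a closed immersion of affine schemes) and thence to `Γ(Y⁺, 𝒪)`.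
* `idempotentLifting_of_isClosedImmersion` — **`(H)` passes to closed subschemes with the same
  closed fibre**: if `c : Y ↪ Y⁺` is a closed immersion over `B` inducing a surjection
  `Y₀ → Y⁺₀`, then `(H_{g⁺}) ⇒ (H_g)`.
* `preconnectedSpace_closedFibre_of_idempotentLifting` — `(H_g)` and `B ≅ Γ(Y, 𝒪_Y)` imply that
  `Y₀` is preconnected (the last lines of the printed proof of Tag 03H2: "`R → H⁰(X_s, 𝒪)` factors
  through `κ(s)`").
* `preconnectedSpace_closedFibre_of_noetherianModel` — **the local connectedness core of Tag 03H2 (1)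
  (input `hConn` of `steinFactorization_geometricallyConnected_of_localConn`) for every `g : Y → Spec B`,
  `B` local, `B ≅ Γ(Y, 𝒪_Y)`, admitting a closed `B`-immersion into a base change `Y' ×_{B₀} B` of a
  proper scheme over a Noetherian ring which is bijective on closed fibres.**

For `Y` closed in `𝐏^r_B` such a model always exists (finitely many equations of the closed fibre
lifted over a finitely generated subring); for general proper `Y` its existence is The Stacks
Project, Tags 09ZR/0A0Q (approximation of proper morphisms), not in the tree.

Everything is proved; the file declares theorems only; no named facts are introduced.

## References

* The Stacks Project, Tag 0G7X (Derived Categories of Schemes, Lemma lemma-proper-idempotent-on-fibre,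
  general case of the proof), Tag 03H2 (More on Morphisms, Theorem 37.53.5, end of proof), Tag 0A0Q.
* A. Grothendieck, J. Dieudonné, EGA IV₃ (1966), §8 (limites projectives de schémas); EGA III₁ 4.3.1.
-/

noncomputable section

open CategoryTheory AlgebraicGeometry Limits TopologicalSpace Opposite

universe u

namespace Literature.AlgebraicGeometry.Morphisms

namespace NoetherianModel

open IsLocalRing

/-! ## Idempotent functions and their non-vanishing loci -/

section Idempotents

variable {X : Scheme.{u}}

/-- An idempotent of a local ring which is not a unit is `0`. [folklore] -/
theorem eq_zero_of_isIdempotentElem_of_not_isUnit {R : Type*} [CommRing R] [IsLocalRing R] {e : R}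
    (he : IsIdempotentElem e) (hu : ¬ IsUnit e) : e = 0 := by
  rcases IsLocalRing.isUnit_or_isUnit_one_sub_self e with h | h
  · exact absurd h hu
  · have h0 : e * (1 - e) = 0 := he.mul_one_sub_self
    exact (IsUnit.mul_left_eq_zero h).mp h0

/-- An idempotent global function with empty non-vanishing locus is `0` (all its germs are non-unit
idempotents of local rings). [folklore] -/
theorem eq_zero_of_basicOpen_eq_bot {e : Γ(X, ⊤)} (he : IsIdempotentElem e) (h : X.basicOpen e = ⊥) :
    e = 0 := by
  apply TopCat.Presheaf.section_ext X.sheaf ⊤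
  intro x hx
  show X.presheaf.germ ⊤ x hx e = X.presheaf.germ ⊤ x hx 0
  rw [map_zero]
  refine eq_zero_of_isIdempotentElem_of_not_isUnit (he.map _) fun hu ↦ ?_
  have : x ∈ X.basicOpen e := (X.mem_basicOpen_top e x).mpr hu
  rw [h] at this
  exact this

/-- **Idempotent functions are determined by their non-vanishing loci.** [folklore] -/
theorem eq_of_basicOpen_eq {e₁ e₂ : Γ(X, ⊤)} (h₁ : IsIdempotentElem e₁) (h₂ : IsIdempotentElem e₂)
    (h : X.basicOpen e₁ = X.basicOpen e₂) : e₁ = e₂ := by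
  have key : ∀ {a b : Γ(X, ⊤)}, IsIdempotentElem a → IsIdempotentElem b →
      X.basicOpen a = X.basicOpen b → a * (1 - b) = 0 := by
    intro a b ha hb hab
    refine eq_zero_of_basicOpen_eq_bot (ha.mul hb.one_sub) ?_
    rw [Scheme.basicOpen_mul, hab, ← Scheme.basicOpen_mul, hb.mul_one_sub_self, Scheme.basicOpen_zero]
  have e1 : e₁ = e₁ * e₂ := by
    have := key h₁ h₂ h
    rw [mul_sub, mul_one, sub_eq_zero] at this
    exact this
  have e2 : e₂ = e₂ * e₁ := by
    have := key h₂ h₁ h.symm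
    rw [mul_sub, mul_one, sub_eq_zero] at this
    exact this
  rw [e1, mul_comm, ← e2]

/-- The non-vanishing locus of an idempotent function is closed (its complement is the
non-vanishing locus of the complementary idempotent). [folklore] -/
theorem compl_basicOpen_eq {e : Γ(X, ⊤)} (he : IsIdempotentElem e) :
    (X.basicOpen e : Set X)ᶜ = (X.basicOpen (1 - e) : Set X) := by
  have hinf : X.basicOpen e ⊓ X.basicOpen (1 - e) = ⊥ := by
    rw [← Scheme.basicOpen_mul, he.mul_one_sub_self, Scheme.basicOpen_zero]
  have hsup : X.basicOpen e ⊔ X.basicOpen (1 - e) = ⊤ := by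
    rw [eq_top_iff]
    rintro x -
    have h1 : X.presheaf.germ ⊤ x trivial e + X.presheaf.germ ⊤ x trivial (1 - e) = 1 := by
      rw [← map_add, add_sub_cancel, map_one]
    rcases IsLocalRing.isUnit_or_isUnit_of_isUnit_add (h1 ▸ isUnit_one) with h | h
    · exact Opens.mem_sup.mpr (Or.inl ((X.mem_basicOpen_top e x).mpr h))
    · exact Opens.mem_sup.mpr (Or.inr ((X.mem_basicOpen_top (1 - e) x).mpr h))
  apply Set.Subset.antisymm
  · intro x hx
    have : x ∈ (X.basicOpen e ⊔ X.basicOpen (1 - e) : X.Opens) := by rw [hsup]; trivial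
    rcases Opens.mem_sup.mp this with h | h
    · exact absurd h hx
    · exact h
  · intro x hx hx'
    have : x ∈ (X.basicOpen e ⊓ X.basicOpen (1 - e) : X.Opens) := ⟨hx', hx⟩
    rw [hinf] at this
    exact this

/-- Hence the non-vanishing locus of an idempotent function is clopen. [folklore] -/
theorem isClopen_basicOpen {e : Γ(X, ⊤)} (he : IsIdempotentElem e) :
    IsClopen (X.basicOpen e : Set X) := by
  refine ⟨⟨?_⟩, (X.basicOpen e).isOpen⟩
  rw [compl_basicOpen_eq he]
  exact (X.basicOpen (1 - e)).isOpen

/-- **Every clopen subset is the non-vanishing locus of an idempotent function** (glue `1` on it and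
`0` on its complement). [folklore] -/
theorem exists_isIdempotentElem_basicOpen_eq (W : X.Opens) (hW : IsClosed (W : Set X)) :
    ∃ e : Γ(X, ⊤), IsIdempotentElem e ∧ X.basicOpen e = W := by
  let V : X.Opens := ⟨(W : Set X)ᶜ, hW.isOpen_compl⟩
  have hWV : W ⊔ V = ⊤ := by
    ext x
    simp only [Opens.coe_sup, Set.mem_union, Opens.coe_top, Set.mem_univ, iff_true, V, Opens.coe_mk,
      Set.mem_compl_iff]
    exact em _
  have hWV' : W ⊓ V = ⊥ := by
    ext x
    simp [V]
  have hsub : Subsingleton Γ(X, W ⊓ V) :=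
    CommRingCat.subsingleton_of_isTerminal (X.sheaf.isTerminalOfEqEmpty hWV')
  obtain ⟨s, hs1, hs0⟩ := FundamentalGroup.exists_glue_two W V (1 : Γ(X, W)) (0 : Γ(X, V))
    (Subsingleton.elim _ _)
  let e : Γ(X, ⊤) := X.presheaf.map (homOfLE (le_of_eq hWV.symm)).op s
  -- germs of `e`
  have hgermW : ∀ x (hx : x ∈ W), X.presheaf.germ ⊤ x trivial e = 1 := by
    intro x hx
    have : X.presheaf.germ ⊤ x trivial e = X.presheaf.germ W x hx
        (X.presheaf.map (homOfLE le_sup_left : W ⟶ W ⊔ V).op s) := by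
      simp only [e]
      rw [X.presheaf.germ_res_apply, X.presheaf.germ_res_apply]
    rw [this, hs1, map_one]
  have hgermV : ∀ x (hx : x ∈ V), X.presheaf.germ ⊤ x trivial e = 0 := by
    intro x hx
    have : X.presheaf.germ ⊤ x trivial e = X.presheaf.germ V x hx
        (X.presheaf.map (homOfLE le_sup_right : V ⟶ W ⊔ V).op s) := by
      simp only [e]
      rw [X.presheaf.germ_res_apply, X.presheaf.germ_res_apply]
    rw [this, hs0, map_zero]
  have hmem : ∀ x, x ∈ W ∨ x ∈ V := fun x ↦ by
    by_cases hx : x ∈ W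
    · exact Or.inl hx
    · exact Or.inr hx
  refine ⟨e, ?_, ?_⟩
  · -- idempotent: check on germs
    apply TopCat.Presheaf.section_ext X.sheaf ⊤
    intro x hx
    show X.presheaf.germ ⊤ x hx (e * e) = X.presheaf.germ ⊤ x hx e
    rw [map_mul]
    rcases hmem x with h | h
    · rw [hgermW x h, mul_one]
    · rw [hgermV x h, mul_zero]
  · ext x
    rw [SetLike.mem_coe, Scheme.mem_basicOpen_top]
    constructor
    · intro hu
      by_contra hx
      rw [hgermV x hx] at hu
      exact not_isUnit_zero hu
    · intro hx
      rw [hgermW x hx]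
      exact isUnit_one

end Idempotents

/-! ## The closed fibre over a local ring and the lifting property `(H)` -/

section ClosedFibre

variable {B : Type u} [CommRing B] [IsLocalRing B]

/-- **`(H)` passes to closed subschemes with the same closed fibre.** Let `c : Y ↪ Y⁺` be a closed
immersion over `Spec B` (`B` local) such that the induced closed immersion of closed fibres
`Y₀ → Y⁺₀` is onto. If every idempotent function on `Y⁺₀` is the restriction of a function on `Y⁺`,
then every idempotent function on `Y₀` is the restriction of a function on `Y`: transport the clopen
non-vanishing locus to `Y⁺₀`, take the idempotent with that locus, lift, restrict along `c`, and
compare non-vanishing loci. [cite: StacksProject, Tag 0G7X (Derived Categories of Schemes, Lemma lemma-proper-idempotent-on-fibre, general case of the proof)] -/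
theorem idempotentLifting_of_isClosedImmersion {Y Yp : Scheme.{u}} (g : Y ⟶ Spec (.of B))
    (gp : Yp ⟶ Spec (.of B)) (c : Y ⟶ Yp) [IsClosedImmersion c] (hc : c ≫ gp = g)
    (hsurj : Function.Surjective (pullback.map g (Spec.map (CommRingCat.ofHom (residue B)))
      gp (Spec.map (CommRingCat.ofHom (residue B))) c (𝟙 _) (𝟙 _)
      (by rw [Category.comp_id, hc]) (by rw [Category.comp_id, Category.id_comp])))
    (H : ∀ e : Γ(pullback gp (Spec.map (CommRingCat.ofHom (residue B))), ⊤), IsIdempotentElem e →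
      e ∈ Set.range (pullback.fst gp (Spec.map (CommRingCat.ofHom (residue B)))).appTop) :
    ∀ e : Γ(pullback g (Spec.map (CommRingCat.ofHom (residue B))), ⊤), IsIdempotentElem e →
      e ∈ Set.range (pullback.fst g (Spec.map (CommRingCat.ofHom (residue B)))).appTop := by
  set q := Spec.map (CommRingCat.ofHom (residue B)) with hq
  intro e he
  set c₀ := pullback.map g q gp q c (𝟙 _) (𝟙 _) (by rw [Category.comp_id, hc])
    (by rw [Category.comp_id, Category.id_comp]) with hc₀
  have hc₀fst : c₀ ≫ pullback.fst gp q = pullback.fst g q ≫ c := pullback.lift_fst _ _ _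
  -- `c₀` is a closed immersion (cancellation: `c₀ ≫ fst = fst ≫ c` is one)
  haveI : IsClosedImmersion q := IsClosedImmersion.spec_of_surjective _ Ideal.Quotient.mk_surjective
  haveI : IsClosedImmersion (pullback.fst gp q) := MorphismProperty.pullback_fst _ _ inferInstance
  haveI : IsClosedImmersion (pullback.fst g q) := MorphismProperty.pullback_fst _ _ inferInstance
  haveI : IsClosedImmersion (c₀ ≫ pullback.fst gp q) := by rw [hc₀fst]; infer_instance
  haveI : IsClosedImmersion c₀ := IsClosedImmersion.of_comp c₀ (pullback.fst gp q)
  -- the clopen `W = c₀(D(e))`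
  have hinj : Function.Injective c₀ := c₀.isClosedEmbedding.injective
  have hWclosed : IsClosed (c₀ '' ((pullback g q).basicOpen e : Set _)) :=
    c₀.isClosedEmbedding.isClosedMap _ (isClopen_basicOpen he).1
  have hWopen : IsOpen (c₀ '' ((pullback g q).basicOpen e : Set _)) := by
    have : (c₀ '' ((pullback g q).basicOpen e : Set _))ᶜ =
        c₀ '' (((pullback g q).basicOpen e : Set _)ᶜ) := by
      rw [Set.image_compl_eq (f := (c₀ : _ → _)) ⟨hinj, hsurj⟩]
    rw [← isClosed_compl_iff, this]
    exact c₀.isClosedEmbedding.isClosedMap _ (isClopen_basicOpen he).2.isClosed_compl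
  let W : (pullback gp q).Opens := ⟨_, hWopen⟩
  obtain ⟨e', he', hW⟩ := exists_isIdempotentElem_basicOpen_eq W hWclosed
  obtain ⟨s', hs'⟩ := H e' he'
  refine ⟨c.appTop s', ?_⟩
  -- `(c^* s')|_{Y₀} = c₀^* e'`, an idempotent with non-vanishing locus `D(e)`
  have h1 : (pullback.fst g q).appTop (c.appTop s') = c₀.appTop e' := by
    rw [← hs', ← CommRingCat.comp_apply, ← Scheme.Hom.comp_appTop, ← hc₀fst, Scheme.Hom.comp_appTop,
      CommRingCat.comp_apply]
  rw [h1]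
  refine eq_of_basicOpen_eq (he'.map _) he ?_
  rw [← Scheme.preimage_basicOpen_top, hW]
  ext x
  simp only [Scheme.Hom.coe_preimage, Set.mem_preimage, SetLike.mem_coe]
  change c₀ x ∈ c₀ '' _ ↔ _
  rw [hinj.mem_set_image]
  rfl

/-- **`(H)` and `B ≅ Γ(Y, 𝒪_Y)` give a preconnected closed fibre** (end of the printed proof of
Tag 03H2: an idempotent `e` of `Γ(Y₀, 𝒪)` is the restriction of a global function, i.e. of an element
of `B`, so it comes from `κ_B`; as `κ_B → Γ(Y₀, 𝒪)` is injective (or `Y₀ = ∅`), `e ∈ {0, 1}`).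
[cite: StacksProject, Tag 03H2 (More on Morphisms, Theorem 37.53.5, end of proof)] -/
theorem preconnectedSpace_closedFibre_of_idempotentLifting {Y : Scheme.{u}} (g : Y ⟶ Spec (.of B))
    [IsIso g.appTop]
    (H : ∀ e : Γ(pullback g (Spec.map (CommRingCat.ofHom (residue B))), ⊤), IsIdempotentElem e →
      e ∈ Set.range (pullback.fst g (Spec.map (CommRingCat.ofHom (residue B)))).appTop) :
    PreconnectedSpace ↥(pullback g (Spec.map (CommRingCat.ofHom (residue B)))) := by
  set q := Spec.map (CommRingCat.ofHom (residue B)) with hq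
  refine Motives.preconnectedSpace_of_isIdempotentElem _ fun e he ↦ ?_
  obtain ⟨s, hs⟩ := H e he
  -- `s = g^* t`
  obtain ⟨t, rfl⟩ : ∃ t, g.appTop t = s := ⟨inv g.appTop s, by
    rw [← CommRingCat.comp_apply, IsIso.inv_hom_id]; rfl⟩
  have h1 : (pullback.fst g q).appTop (g.appTop t) = (pullback.snd g q).appTop (q.appTop t) := by
    rw [← CommRingCat.comp_apply, ← Scheme.Hom.comp_appTop, pullback.condition, Scheme.Hom.comp_appTop,
      CommRingCat.comp_apply]
  rw [h1] at hs
  -- through the field `κ_B`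
  set ψ : ResidueField B →+* Γ(pullback g q, ⊤) :=
    (pullback.snd g q).appTop.hom.comp (Scheme.ΓSpecIso (.of (ResidueField B))).inv.hom with hψ
  obtain ⟨c, hc⟩ : ∃ c : ResidueField B, ψ c = e := by
    refine ⟨(Scheme.ΓSpecIso (.of (ResidueField B))).hom (q.appTop t), ?_⟩
    rw [← hs, hψ, RingHom.comp_apply]
    change (pullback.snd g q).appTop.hom (((Scheme.ΓSpecIso (.of (ResidueField B))).hom ≫
      (Scheme.ΓSpecIso (.of (ResidueField B))).inv) (q.appTop t)) = _
    rw [Iso.hom_inv_id]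
    rfl
  rcases subsingleton_or_nontrivial Γ(pullback g q, ⊤) with hsub | hnt
  · exact Or.inl (Subsingleton.elim _ _)
  · have hinj : Function.Injective ψ := ψ.injective
    have hcc : c * c = c := hinj (by rw [map_mul, hc]; exact he)
    have : c = 0 ∨ c = 1 := by
      have h0 : c * (c - 1) = 0 := by rw [mul_sub, mul_one, hcc, sub_self]
      rcases mul_eq_zero.mp h0 with h | h
      · exact Or.inl h
      · exact Or.inr (sub_eq_zero.mp h)
    rcases this with rfl | rfl
    · exact Or.inl (by rw [← hc, map_zero])
    · exact Or.inr (by rw [← hc, map_one])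

end ClosedFibre

/-! ## `(H)` for a base change of a proper scheme over a Noetherian ring -/

section Model

variable {B : Type u} [CommRing B] [IsLocalRing B] {B₀ : Type u} [CommRing B₀] [IsNoetherianRing B₀]
  (φ : B₀ →+* B) {Yp Y' : Scheme.{u}} (gp : Yp ⟶ Spec (.of B)) (g' : Y' ⟶ Spec (.of B₀)) [IsProper g']
  (pr : Yp ⟶ Y') (sq : IsPullback pr gp g' (Spec.map (CommRingCat.ofHom φ)))

include sq in
/-- **`(H)` for a base change `Y⁺ = Y' ×_{B₀} B` of a proper scheme `Y'` over a Noetherian ring `B₀`**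
(`B` local with residue field `κ`, any `B₀ → B`): every idempotent function `e` on the closed fibre
`Y⁺₀ = Y⁺ ×_B κ` is the restriction of a function on `Y⁺`. Proof: `Y⁺₀ = Y' ×_{B₀} κ` maps to
`T = Spec Γ(Y', 𝒪) ×_{B₀} Spec κ` by a base change `h` of `Y' → Spec Γ(Y', 𝒪)`, which is geometrically
connected (Zariski's connectedness theorem over the Noetherian ring `B₀`,
`geometricallyConnected_toSpecΓ_of_isProper`); `T` is finite over `κ` (`Γ(Y', 𝒪)` is finite over `B₀`,
`finite_algebraMapΓ_of_isProper`), hence discrete; so the clopen `D(e)` is `h⁻¹` of a clopen of `T`,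
`e = h^* ε` for the idempotent `ε` of `Γ(T, 𝒪)` with that locus, and `ε` lifts along the closed
immersion of affine schemes `T ↪ T' = Spec Γ(Y', 𝒪) ×_{B₀} Spec B`, through which `Y⁺ → T` factors.
This replaces the limit argument of the printed proof (Tag 0G7X, general case) by a single Noetherian
model. [cite: StacksProject, Tag 0G7X (Derived Categories of Schemes, Lemma lemma-proper-idempotent-on-fibre, general case of the proof)] -/
theorem idempotentLifting_of_isPullback :
    ∀ e : Γ(pullback gp (Spec.map (CommRingCat.ofHom (residue B))), ⊤), IsIdempotentElem e →
      e ∈ Set.range (pullback.fst gp (Spec.map (CommRingCat.ofHom (residue B)))).appTop := by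
  set q := Spec.map (CommRingCat.ofHom (residue B)) with hq
  intro e he
  haveI : IsClosedImmersion q := IsClosedImmersion.spec_of_surjective _ Ideal.Quotient.mk_surjective
  -- the Stein map `Y' → Spec Γ(Y', 𝒪) → Spec B₀` of the model
  let a₀ : B₀ →+* Γ(Y', ⊤) := algebraMapΓ g'
  let sB : Spec (.of Γ(Y', ⊤)) ⟶ Spec (.of B₀) := Spec.map (CommRingCat.ofHom a₀)
  let sφ : Spec (.of B) ⟶ Spec (.of B₀) := Spec.map (CommRingCat.ofHom φ)
  have hfac : Y'.toSpecΓ ≫ sB = g' := ZariskiProj.toSpecΓ_SpecMap_algebraMapΓ g'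
  -- `T' = Spec Γ(Y') ×_{B₀} Spec B`, `v : Y⁺ → T'`; `T = T' ×_B Spec κ`, `h : Y⁺₀ → T`
  let v : Yp ⟶ pullback sB sφ := pullback.lift (pr ≫ Y'.toSpecΓ) gp (by rw [Category.assoc, hfac]; exact sq.w)
  let u := pullback.fst (pullback.snd sB sφ) q
  let tk := pullback.snd (pullback.snd sB sφ) q
  let h : pullback gp q ⟶ pullback (pullback.snd sB sφ) q :=
    pullback.lift (pullback.fst gp q ≫ v) (pullback.snd gp q)
      (by rw [Category.assoc, pullback.lift_snd]; exact pullback.condition)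
  have hhu : h ≫ u = pullback.fst gp q ≫ v := pullback.lift_fst _ _ _
  have hhk : h ≫ tk = pullback.snd gp q := pullback.lift_snd _ _ _
  -- `h` is a base change of `Y' → Spec Γ(Y', 𝒪)`
  have sqF : IsPullback (pullback.fst gp q) (pullback.snd gp q) gp q := IsPullback.of_hasPullback gp q
  have big : IsPullback (pullback.fst gp q ≫ pr) (pullback.snd gp q) g' (q ≫ sφ) := sqF.paste_horiz sq
  have big' : IsPullback (pullback.fst gp q ≫ pr) (h ≫ tk) (Y'.toSpecΓ ≫ sB) (q ≫ sφ) := by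
    rw [hhk, hfac]; exact big
  have sqT' : IsPullback (pullback.fst sB sφ) (pullback.snd sB sφ) sB sφ := IsPullback.of_hasPullback _ _
  have sqT : IsPullback u tk (pullback.snd sB sφ) q := IsPullback.of_hasPullback _ _
  have sqTT : IsPullback (u ≫ pullback.fst sB sφ) tk sB (q ≫ sφ) := (sqT.flip.paste_vert sqT'.flip).flip
  have p : (pullback.fst gp q ≫ pr) ≫ Y'.toSpecΓ = h ≫ (u ≫ pullback.fst sB sφ) := by
    rw [← Category.assoc h, hhu, Category.assoc, Category.assoc, pullback.lift_fst]
  have sqh : IsPullback (pullback.fst gp q ≫ pr) h Y'.toSpecΓ (u ≫ pullback.fst sB sφ) :=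
    big'.of_bot p sqTT
  -- the fibres of `h` are preconnected (Zariski's connectedness theorem over `B₀`)
  haveI : IsNoetherianRing Γ(Spec (.of B₀), ⊤) :=
    isNoetherianRing_of_ringEquiv B₀ (Scheme.ΓSpecIso (.of B₀)).commRingCatIsoToRingEquiv.symm
  have hgc : GeometricallyConnected Y'.toSpecΓ := geometricallyConnected_toSpecΓ_of_isProper g'
  have hfib : ∀ τ : ↥(pullback (pullback.snd sB sφ) q), _root_.IsPreconnected ((h : _ → _) ⁻¹' {τ}) := by
    intro τ
    let ρ := (pullback (pullback.snd sB sφ) q).fromSpecResidueField τ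
    have sqρ : IsPullback (pullback.fst h ρ) (pullback.snd h ρ) h ρ := IsPullback.of_hasPullback _ _
    have sqP := sqρ.paste_horiz sqh
    haveI : ConnectedSpace ↥(pullback h ρ) := hgc.geometrically_connectedSpace _ _ _ sqP
    have hrange : (h : _ → _) ⁻¹' {τ} = Set.range (pullback.fst h ρ) := by
      rw [Scheme.Pullback.range_fst, Scheme.range_fromSpecResidueField]
    rw [hrange]
    exact isPreconnected_range (pullback.fst h ρ).continuous
  -- `T` is finite over `κ`, hence discrete
  haveI : IsFinite sB := (IsFinite.SpecMap_iff _).mpr (finite_algebraMapΓ_of_isProper g')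
  haveI : IsFinite (pullback.snd sB sφ) := MorphismProperty.pullback_snd _ _ inferInstance
  haveI hfin : IsFinite tk := MorphismProperty.pullback_snd _ _ inferInstance
  obtain ⟨hTaff, hTfin⟩ := (HasAffineProperty.iff_of_isAffine (P := @IsFinite)).mp hfin
  haveI := hTaff
  haveI : IsArtinianRing Γ(Spec (.of (ResidueField B)), ⊤) :=
    (Scheme.ΓSpecIso (.of (ResidueField B))).commRingCatIsoToRingEquiv.symm.isArtinianRing
  haveI : IsArtinianRing Γ(pullback (pullback.snd sB sφ) q, ⊤) := by
    letI := tk.appTop.hom.toAlgebra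
    haveI : Module.Finite Γ(Spec (.of (ResidueField B)), ⊤) Γ(pullback (pullback.snd sB sφ) q, ⊤) := hTfin
    exact IsArtinianRing.of_finite Γ(Spec (.of (ResidueField B)), ⊤) _
  haveI : IsLocallyArtinian (Spec Γ(pullback (pullback.snd sB sφ) q, ⊤)) :=
    Scheme.isLocallyArtinianScheme_Spec.mpr inferInstance
  haveI : IsLocallyArtinian (pullback (pullback.snd sB sφ) q) :=
    IsLocallyArtinian.of_isImmersion (f := (pullback (pullback.snd sB sφ) q).isoSpec.hom)
  -- the clopen `h(D(e))` and its idempotent `ε`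
  have hWpre : (h : _ → _) ⁻¹' ((h : _ → _) '' ((pullback gp q).basicOpen e : Set _)) =
      ((pullback gp q).basicOpen e : Set _) := by
    apply Set.Subset.antisymm
    · rintro x ⟨w, hw, hwx⟩
      exact (hfib (h x)).subset_isClopen (isClopen_basicOpen he) ⟨w, hwx, hw⟩ rfl
    · exact Set.subset_preimage_image _ _
  let WT : (pullback (pullback.snd sB sφ) q).Opens :=
    ⟨(h : _ → _) '' ((pullback gp q).basicOpen e : Set _), isOpen_discrete _⟩
  obtain ⟨ε, hε, hεW⟩ := exists_isIdempotentElem_basicOpen_eq WT (isClosed_discrete _)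
  -- lift `ε` along the closed immersion of affine schemes `u : T → T'`, then pull back along `v`
  obtain ⟨ε', hε'⟩ := (IsClosedImmersion.isAffine_surjective_of_isAffine u).2 ε
  refine ⟨v.appTop ε', ?_⟩
  have h1 : (pullback.fst gp q).appTop (v.appTop ε') = h.appTop ε := by
    rw [← hε', ← CommRingCat.comp_apply, ← Scheme.Hom.comp_appTop, ← hhu, Scheme.Hom.comp_appTop,
      CommRingCat.comp_apply]
  rw [h1]
  refine eq_of_basicOpen_eq (hε.map _) he ?_
  rw [← Scheme.preimage_basicOpen_top, hεW]
  exact Opens.ext hWpre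

include sq in
/-- **The local connectedness core of Tag 03H2 (1) from a Noetherian proper model.** Let `B` be a local
ring, `g : Y → Spec B` with `B ≅ Γ(Y, 𝒪_Y)`, and suppose `Y` admits a closed `B`-immersion
`c : Y ↪ Y⁺` into a base change `Y⁺ = Y' ×_{B₀} B` of a proper scheme `Y'` over a Noetherian ring `B₀`
(any `B₀ → B`) which is onto on closed fibres. Then the closed fibre `Y ×_B κ_B` is preconnected
(`idempotentLifting_of_isPullback`, `idempotentLifting_of_isClosedImmersion`,
`preconnectedSpace_closedFibre_of_idempotentLifting`). This is the input `hConn` of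
`steinFactorization_geometricallyConnected_of_localConn` for such `g`.
[cite: StacksProject, Tag 0G7X (Derived Categories of Schemes, Lemma lemma-proper-idempotent-on-fibre) and Tag 03H2 (More on Morphisms, Theorem 37.53.5 (1), proof)] -/
theorem preconnectedSpace_closedFibre_of_noetherianModel {Y : Scheme.{u}} (g : Y ⟶ Spec (.of B))
    [IsIso g.appTop] (c : Y ⟶ Yp) [IsClosedImmersion c] (hc : c ≫ gp = g)
    (hsurj : Function.Surjective (pullback.map g (Spec.map (CommRingCat.ofHom (residue B)))
      gp (Spec.map (CommRingCat.ofHom (residue B))) c (𝟙 _) (𝟙 _)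
      (by rw [Category.comp_id, hc]) (by rw [Category.comp_id, Category.id_comp]))) :
    PreconnectedSpace ↥(pullback g (Spec.map (CommRingCat.ofHom (residue B)))) :=
  preconnectedSpace_closedFibre_of_idempotentLifting g
    (idempotentLifting_of_isClosedImmersion g gp c hc hsurj
      (idempotentLifting_of_isPullback φ gp g' pr sq))

end Model

end NoetherianModel

end Literature.AlgebraicGeometry.Morphisms

end
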